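import Literature.Computability.Complexity.FoldBricks
import Literature.Computability.Complexity.ListFoldBricks
import Literature.Computability.Complexity.StackBricksArith
import Literature.Computability.Complexity.FPStringBricks
import Literature.Computability.Complexity.PlumbingBricks
import Literature.Computability.Complexity.HashBricks
import Literature.Computability.Complexity.TruthTableClosure
import Literature.Computability.Complexity.LengthCompare
import HarnessLib

/-!
# The machine of the search-to-decision reduction for LWE, I: the string maps and their complexity

The distinguisher of `regev_search_to_decision` (`Cryptography/LWESearchToDecision.lean`) is the
one-query truth-table algorithm `ttAlg Q 1 D`; this file builds its query map `Q` and verdict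
language `D` in the tree's algebra of `FP` string functions and proves `Q ∈ FP`, `D ∈ P`.  Inputs
are `⟨⟨x, r⟩, a⟩` with `x = ⟨bin n, ⟨bin q, ⟨1^{m'}, body items⟩⟩⟩` the code of `m' = C q² + m` LWE
samples (`encodeLWESamples`; item `= ⟨⟨1ⁿ, body [bin a₀, …, bin a_{n-1}]⟩, bin b⟩`), `r` the (unused)
coins and `a` the oracle's answer.

* `S2D.tunF C x = 1^{C q²}` (`q` read in binary off the header, converted with the ruler `x`);
* **`S2D.queryFn C`** — `⟨⟨x, r⟩, ε⟩ ↦ ⟨bin n, ⟨bin q, ⟨1^{m'} ⇂ T, sndP^T (body items)⟩⟩⟩`, `T = C q²`: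
  the code of the LAST `m' - T` samples (a projection: drop `T` unary symbols, skip `T` items);
  `queryFn_mem_FP`;
* **`S2D.resFn`** (one-bit) — on `⟨⟨⟨x, r⟩, a⟩, 1ʲ⟩`: `[j < T ∧ residual_j = 0]`, the residual of item
  `j` being `b_j - Σᵢ aⱼᵢ sᵢ (mod q)` with `sᵢ = decodeNat` of the `i`-th component of the answer's
  body if the answer's unary header has length `n`, and `sᵢ = 0` otherwise (the reading of
  `decodeSecret`; the sum is the indexed fold `Brick.foldLoop addFn` of products, the answer's
  numerals canonicalised by `Brick.canonF`); `resFn_mem_FP`, `S2D.resLang ∈ P`;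
* **`S2D.evalFn k`** (one-bit) — on `⟨w, bits⟩`: `[(2k+1) T ≤ 2k · q · #ones(bits)]` in unary
  (`HashBricks.umulFn`, `popCountFn`, `binToUnaryFn`); `S2D.evalLang k ∈ P`;
* **`S2D.verdictLang C k = ttLang id X (evalLang C k) (resLang C) ∈ P`** (`TruthTableClosure.ttLang_mem_P`).

The values of these maps on codes of LWE samples (`IsS2DQueryMap`, `IsS2DVerdict`) are computed in
`LWESearchToDecisionMachineSpec.lean`.

## References

* O. Regev, *On lattices, learning with errors, random linear codes, and cryptography*, J. ACM 56
  (2009), §1 (p. 4), §4 [RegevLWE2009].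
* S. Arora, B. Barak, *Computational Complexity: A Modern Approach*, CUP 2009, §1.3 (polynomial
  time is closed under composition and bounded loops) [AroraBarakCC2009].
-/

noncomputable section

namespace Literature.Computability.Complexity

open _root_.Computability Polynomial Brick PRelSigPi

namespace S2D

/-! ### Fields of the code `x = ⟨bin n, ⟨bin q, ⟨1^{m'}, body items⟩⟩⟩` -/

/-- `1^{C q²}` off the code `x`: `q` in binary is the second field, made unary against the ruler `x`
itself (`|x| ≥ m' ≥ C q² ≥ q` on codes of samples), then squared and scaled in unary. [folklore] -/
def tunF (C : ℕ) : List Bool → List Bool :=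
  HashBricks.umulFn ∘ fanoutFn (fun _ => ones C)
    (HashBricks.umulFn ∘ fanoutFn (binToUnaryFn ∘ fanoutFn id (nthF 1)) (binToUnaryFn ∘ fanoutFn id (nthF 1)))

/-- Value of `tunF`. [folklore] -/
theorem tunF_apply (C : ℕ) (x : List Bool) :
    tunF C x = ones (C * (min (bitsToNat (nthF 1 x)) x.length * min (bitsToNat (nthF 1 x)) x.length)) := by
  simp [tunF, HashBricks.umulFn_apply]

/-- `tunF C ∈ FP`. [folklore] -/
theorem tunF_mem_FP (C : ℕ) : tunF C ∈ FP := by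
  unfold tunF
  exact comp_mem_FP HashBricks.umulFn_mem_FP (fanoutFn_mem_FP (const_mem_FP _)
    (comp_mem_FP HashBricks.umulFn_mem_FP (fanoutFn_mem_FP
      (comp_mem_FP binToUnaryFn_mem_FP (fanoutFn_mem_FP OracleCompose.id_mem_FP (nthF_mem_FP 1)))
      (comp_mem_FP binToUnaryFn_mem_FP (fanoutFn_mem_FP OracleCompose.id_mem_FP (nthF_mem_FP 1))))))

/-! ### The query map -/

/-- **The query map**: on `⟨⟨x, r⟩, c⟩` with `x = ⟨N, ⟨Qb, ⟨U, L⟩⟩⟩`, the code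
`⟨N, ⟨Qb, ⟨U ⇂ T, sndP^T L⟩⟩⟩`, `T = |tunF C x|` (drop `T` unary symbols of the sample count, skip
`T` items of the list). [cite: RegevLWE2009, §1 (p. 4) and §4] -/
def queryFn (C : ℕ) : List Bool → List Bool :=
  (fanoutFn (nthF 0) (fanoutFn (nthF 1)
    (fanoutFn (Plumb.dropFn ∘ fanoutFn (tunF C) (nthF 2)) (nthRest ∘ fanoutFn (tunF C) (sndPow 2))))) ∘
    fstF ∘ fstF

/-- Value of the query map on a double pair. [folklore] -/
theorem queryFn_apply (C : ℕ) (N Qb U L r c : List Bool) :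
    queryFn C (boolPair (boolPair (boolPair N (boolPair Qb (boolPair U L))) r) c) =
      boolPair N (boolPair Qb (boolPair (U.drop (tunF C (boolPair N (boolPair Qb (boolPair U L)))).length)
        (sndP^[(tunF C (boolPair N (boolPair Qb (boolPair U L)))).length] L))) := by
  simp [queryFn, nthRest, nthF, sndPow]

/-- **`queryFn C ∈ FP`.** [cite: AroraBarakCC2009, §1.3] -/
theorem queryFn_mem_FP (C : ℕ) : queryFn C ∈ FP := by
  unfold queryFn
  exact comp_mem_FP
    (fanoutFn_mem_FP (nthF_mem_FP 0) (fanoutFn_mem_FP (nthF_mem_FP 1)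
      (fanoutFn_mem_FP (comp_mem_FP Plumb.dropFn_mem_FP (fanoutFn_mem_FP (tunF_mem_FP C) (nthF_mem_FP 2)))
        (comp_mem_FP nthRest_mem_FP (fanoutFn_mem_FP (tunF_mem_FP C) (sndPow_mem_FP 2))))))
    (comp_mem_FP fstF_mem_FP fstF_mem_FP)

/-! ### The residual test for one item -/

section Residual

variable (C : ℕ)

/-- The sample code `x` off the argument `z = ⟨⟨⟨x, r⟩, a⟩, u⟩` of the item test. [folklore] -/
def xOf : List Bool → List Bool := fstF ∘ fstF ∘ fstF
/-- The oracle answer `a` off `z`. [folklore] -/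
def aOf : List Bool → List Bool := sndF ∘ fstF
/-- The item `j = |u|` of the sample list. [folklore] -/
def itemOf : List Bool → List Bool := elemFn ∘ fanoutFn sndF (sndPow 2 ∘ xOf)
/-- The body of the `a`-components of the item. [folklore] -/
def asOf : List Bool → List Bool := sndF ∘ fstF ∘ itemOf
/-- The numeral `b` of the item. [folklore] -/
def bOf : List Bool → List Bool := sndF ∘ itemOf
/-- The body of the answer's secret code. [folklore] -/
def svOf : List Bool → List Bool := sndF ∘ fstF ∘ aOf
/-- `[the answer's unary header has length n]` (the well-formedness test of `decodeSecret`). [folklore] -/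
def hdrOk : List Bool → List Bool := eqValFn ∘ fanoutFn (lenBinF ∘ fstF ∘ fstF ∘ aOf) (nthF 0 ∘ xOf)

/-- The `i`-th product `aⱼᵢ · sᵢ` on `⟨z, 1ⁱ⟩` (the answer's numeral canonicalised, so that it is read
as `decodeNat` reads it). [folklore] -/
def pieceFn : List Bool → List Bool :=
  prodFn ∘ fanoutFn (elemFn ∘ fanoutFn sndF (asOf ∘ fstF)) (canonF ∘ elemFn ∘ fanoutFn sndF (svOf ∘ fstF))

/-- The inner product `Σ_{i<n} aⱼᵢ sᵢ` in binary: the indexed sum fold of the (clipped) pieces, `n`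
read off the header, clocked by `|z|`. [folklore] -/
def dotFn : List Bool → List Bool :=
  sndPow 2 ∘ foldLoop addFn (clipF 2 pieceFn) X ∘
    fanoutFn id (fanoutFn (nthF 0 ∘ xOf) (fanoutFn (fun _ => []) (fun _ => [])))

/-- `[Σᵢ aⱼᵢ sᵢ ≡ bⱼ (mod q)]`. [folklore] -/
def resDot : List Bool → List Bool :=
  eqValFn ∘ fanoutFn (remFn ∘ fanoutFn dotFn (nthF 1 ∘ xOf)) (remFn ∘ fanoutFn bOf (nthF 1 ∘ xOf))

/-- `[bⱼ ≡ 0 (mod q)]` (the residual against the junk secret `0`). [folklore] -/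
def resZero : List Bool → List Bool :=
  eqValFn ∘ fanoutFn (remFn ∘ fanoutFn bOf (nthF 1 ∘ xOf)) (fun _ => [])

/-- **The item test** `[ |u| < T ∧ residual_{|u|} = 0 ]`. [cite: RegevLWE2009, §1 (p. 4) and §4] -/
def resFn : List Bool → List Bool :=
  andFn (ltLenF ∘ fanoutFn sndF (tunF C ∘ xOf)) (iteFn hdrOk resDot resZero)

/-- `xOf ∈ FP`. [folklore] -/
theorem xOf_mem_FP : xOf ∈ FP := by
  unfold xOf; exact comp_mem_FP fstF_mem_FP (comp_mem_FP fstF_mem_FP fstF_mem_FP)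
/-- `aOf ∈ FP`. [folklore] -/
theorem aOf_mem_FP : aOf ∈ FP := by
  unfold aOf; exact comp_mem_FP sndF_mem_FP fstF_mem_FP
/-- `itemOf ∈ FP`. [folklore] -/
theorem itemOf_mem_FP : itemOf ∈ FP := by
  unfold itemOf
  exact comp_mem_FP elemFn_mem_FP (fanoutFn_mem_FP sndF_mem_FP (comp_mem_FP (sndPow_mem_FP 2) xOf_mem_FP))
/-- `asOf ∈ FP`. [folklore] -/
theorem asOf_mem_FP : asOf ∈ FP := by
  unfold asOf; exact comp_mem_FP sndF_mem_FP (comp_mem_FP fstF_mem_FP itemOf_mem_FP)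
/-- `bOf ∈ FP`. [folklore] -/
theorem bOf_mem_FP : bOf ∈ FP := by
  unfold bOf; exact comp_mem_FP sndF_mem_FP itemOf_mem_FP
/-- `svOf ∈ FP`. [folklore] -/
theorem svOf_mem_FP : svOf ∈ FP := by
  unfold svOf; exact comp_mem_FP sndF_mem_FP (comp_mem_FP fstF_mem_FP aOf_mem_FP)
/-- `hdrOk ∈ FP`. [folklore] -/
theorem hdrOk_mem_FP : hdrOk ∈ FP := by
  unfold hdrOk
  exact comp_mem_FP eqValFn_mem_FP (fanoutFn_mem_FP
    (comp_mem_FP lenBinF_mem_FP (comp_mem_FP fstF_mem_FP (comp_mem_FP fstF_mem_FP aOf_mem_FP)))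
    (comp_mem_FP (nthF_mem_FP 0) xOf_mem_FP))
/-- `pieceFn ∈ FP`. [folklore] -/
theorem pieceFn_mem_FP : pieceFn ∈ FP := by
  unfold pieceFn
  exact comp_mem_FP prodFn_mem_FP (fanoutFn_mem_FP
    (comp_mem_FP elemFn_mem_FP (fanoutFn_mem_FP sndF_mem_FP (comp_mem_FP asOf_mem_FP fstF_mem_FP)))
    (comp_mem_FP canonF_mem_FP (comp_mem_FP elemFn_mem_FP
      (fanoutFn_mem_FP sndF_mem_FP (comp_mem_FP svOf_mem_FP fstF_mem_FP)))))
/-- `dotFn ∈ FP` (the clipped sum fold). [cite: AroraBarakCC2009, §1.3] -/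
theorem dotFn_mem_FP : dotFn ∈ FP := by
  unfold dotFn
  exact comp_mem_FP (sndPow_mem_FP 2) (comp_mem_FP
    (foldLoop_clipF_mem_FP 2 addFn_mem_FP length_addFn_le pieceFn_mem_FP X)
    (fanoutFn_mem_FP OracleCompose.id_mem_FP (fanoutFn_mem_FP (comp_mem_FP (nthF_mem_FP 0) xOf_mem_FP)
      (fanoutFn_mem_FP (const_mem_FP _) (const_mem_FP _)))))
/-- `resDot ∈ FP`. [folklore] -/
theorem resDot_mem_FP : resDot ∈ FP := by
  unfold resDot
  exact comp_mem_FP eqValFn_mem_FP (fanoutFn_mem_FP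
    (comp_mem_FP remFn_mem_FP (fanoutFn_mem_FP dotFn_mem_FP (comp_mem_FP (nthF_mem_FP 1) xOf_mem_FP)))
    (comp_mem_FP remFn_mem_FP (fanoutFn_mem_FP bOf_mem_FP (comp_mem_FP (nthF_mem_FP 1) xOf_mem_FP))))
/-- `resZero ∈ FP`. [folklore] -/
theorem resZero_mem_FP : resZero ∈ FP := by
  unfold resZero
  exact comp_mem_FP eqValFn_mem_FP (fanoutFn_mem_FP
    (comp_mem_FP remFn_mem_FP (fanoutFn_mem_FP bOf_mem_FP (comp_mem_FP (nthF_mem_FP 1) xOf_mem_FP)))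
    (const_mem_FP _))
/-- **`resFn C ∈ FP`.** [cite: AroraBarakCC2009, §1.3] -/
theorem resFn_mem_FP : resFn C ∈ FP := by
  unfold resFn
  exact andFn_mem_FP
    (comp_mem_FP ltLenF_mem_FP (fanoutFn_mem_FP sndF_mem_FP (comp_mem_FP (tunF_mem_FP C) xOf_mem_FP)))
    (iteFn_mem_FP hdrOk_mem_FP resDot_mem_FP resZero_mem_FP)

/-- `hdrOk` is one-bit. [folklore] -/
theorem oneBit_hdrOk : OneBit hdrOk := oneBit_eqValFn.comp _
/-- `resDot` is one-bit. [folklore] -/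
theorem oneBit_resDot : OneBit resDot := oneBit_eqValFn.comp _
/-- `resZero` is one-bit. [folklore] -/
theorem oneBit_resZero : OneBit resZero := oneBit_eqValFn.comp _
/-- `resFn C` is one-bit. [folklore] -/
theorem oneBit_resFn : OneBit (resFn C) :=
  oneBit_andFn (oneBit_ltLenF.comp _) (OneBit.ite oneBit_hdrOk oneBit_resDot oneBit_resZero)

/-- **The item language** `{z | resFn C z = [1]}`. [folklore] -/
def resLang : Language Bool := {z | resFn C z = [true]}

/-- **`resLang C ∈ P`.** [cite: AroraBarakCC2009, §1.3] -/
theorem resLang_mem_P : resLang C ∈ Classes.P :=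
  mem_P_of_mem_FP (resFn_mem_FP C) _ fun z => ⟨fun h => h, fun h => by
    obtain ⟨b, hb⟩ := oneBit_resFn C z
    cases b
    · exact hb
    · exact absurd hb h⟩

end Residual

/-! ### The threshold evaluator and the verdict -/

section Eval

variable (C k : ℕ)

/-- **The threshold test** on `⟨w, bits⟩`, `w = ⟨⟨x, r⟩, a⟩`: `[(2k+1) T ≤ 2k q · #ones(bits)]`, all
products in unary (`q` and the count made unary against the rulers `x`, `bits`). [cite: RegevLWE2009, §1 (p. 4) and §4] -/
def evalFn : List Bool → List Bool :=
  notFn (ltLenF ∘ fanoutFn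
    (HashBricks.umulFn ∘ fanoutFn (fun _ => ones (2 * k))
      (HashBricks.umulFn ∘ fanoutFn (binToUnaryFn ∘ fanoutFn id (nthF 1) ∘ fstF ∘ fstF ∘ fstF)
        (binToUnaryFn ∘ fanoutFn sndF (HashBricks.popCountFn ∘ sndF))))
    (HashBricks.umulFn ∘ fanoutFn (fun _ => ones (2 * k + 1)) (tunF C ∘ fstF ∘ fstF ∘ fstF)))

/-- `evalFn C k ∈ FP`. [cite: AroraBarakCC2009, §1.3] -/
theorem evalFn_mem_FP : evalFn C k ∈ FP := by
  unfold evalFn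
  exact notFn_mem_FP (comp_mem_FP ltLenF_mem_FP (fanoutFn_mem_FP
    (comp_mem_FP HashBricks.umulFn_mem_FP (fanoutFn_mem_FP (const_mem_FP _)
      (comp_mem_FP HashBricks.umulFn_mem_FP (fanoutFn_mem_FP
        (comp_mem_FP binToUnaryFn_mem_FP (comp_mem_FP
          (fanoutFn_mem_FP OracleCompose.id_mem_FP (nthF_mem_FP 1))
          (comp_mem_FP fstF_mem_FP (comp_mem_FP fstF_mem_FP fstF_mem_FP))))
        (comp_mem_FP binToUnaryFn_mem_FP (fanoutFn_mem_FP sndF_mem_FP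
          (comp_mem_FP HashBricks.popCountFn_mem_FP sndF_mem_FP)))))))
    (comp_mem_FP HashBricks.umulFn_mem_FP (fanoutFn_mem_FP (const_mem_FP _)
      (comp_mem_FP (tunF_mem_FP C) (comp_mem_FP fstF_mem_FP (comp_mem_FP fstF_mem_FP fstF_mem_FP)))))))

/-- `evalFn C k` is one-bit. [folklore] -/
theorem oneBit_evalFn : OneBit (evalFn C k) := oneBit_notFn (oneBit_ltLenF.comp _)

/-- **The threshold language** `{e | evalFn C k e = [1]}`. [folklore] -/
def evalLang : Language Bool := {e | evalFn C k e = [true]}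

/-- **`evalLang C k ∈ P`.** [cite: AroraBarakCC2009, §1.3] -/
theorem evalLang_mem_P : evalLang C k ∈ Classes.P :=
  mem_P_of_mem_FP (evalFn_mem_FP C k) _ fun e => ⟨fun h => h, fun h => by
    obtain ⟨b, hb⟩ := oneBit_evalFn C k e
    cases b
    · exact hb
    · exact absurd hb h⟩

/-- **The verdict language**: the truth-table combination asking, for `j < |w|`, whether
`⟨w, 1ʲ⟩ ∈ resLang C` and accepting iff `⟨w, answer bits⟩ ∈ evalLang C k`, i.e. iff
`(2k+1) T ≤ 2k q · #{j < T | residual_j = 0}`. [cite: RegevLWE2009, §1 (p. 4) and §4] -/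
def verdictLang : Language Bool := ttLang id X (evalLang C k) (resLang C)

/-- **`verdictLang C k ∈ P`** (`P` is closed under polynomial-time truth-table reductions,
`ttLang_mem_P`). [cite: AroraBarakCC2009, §1.3] -/
theorem verdictLang_mem_P : verdictLang C k ∈ Classes.P :=
  ttLang_mem_P OracleCompose.id_mem_FP (evalLang_mem_P C k) (resLang_mem_P C)

end Eval

end S2D

end Literature.Computability.Complexity

end
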